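import Literature.MathematicalPhysics.QuantumLattice.PairFieldCarrierBoundAssembly
import Literature.MathematicalPhysics.QuantumLattice.PairFieldYangCeiling
import Literature.MathematicalPhysics.QuantumLattice.HubbardAtomicLimit
import HarnessLib

/-!
# No pair-field order without charge carriers: `⟨Δ_g† Δ_g⟩ ≤ 20 L² ‖g‖² ((L² - N + 3) ‖ψ‖² + 2 ⟨N_d⟩)`

The carrier bound of `PairFieldCarrierBoundCore` / `PairFieldCarrierBoundAssembly`, instantiated
for Scalapino's pair field `Δ_g = Σ_x P_x` on the fermionic torus `(ℤ/Lℤ)²`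
(`PairCorrelations.pairField`): the family of elementary terms is indexed by
`j = (x, e, κ) ∈ (ℤ/Lℤ)² × ({0} ∪ unitSteps) × {↑, ↓}`, with `T_j = c_{(x,κ)} c_{(x+e, κ̄)}`,
weight `w_j = ± g(e)/√2`, and partner orbital `o_j = (x, κ̄)`.

* `pairField_mulVec_apply_eq_sum` — `(Δ_g ψ)(s) = Σ_j w_j (T_j ψ)(s)`;
* `sum_norm_sq_weight` — `Σ_j |w_j|² = L² Σ_e g(e)²`; `near_cases`, `card_le_thirty` — every `j` has
  at most `30` non-far partners (`x' = x`, `x' = x + e`, or `x' + e' = x`);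
* `sum_family_siteWeight` — a site weight summed over the family is counted `10` times;
  `sum_holeInd_add_card` — `#holes(t) + #t = L² + #doublons(t)`; `sum_holeWeight_eq_of_isNParticle`,
  `sum_doublonWeight_eq_re_expect` — hole weight `= (L² - N)‖ψ‖² +` doublon weight `= ⟨N_d⟩`;
* `re_expect_pairField_conjTranspose_mul_le_carrier` — **for every Fock vector `ψ` of particle
  number `N`: `Re ⟨ψ, Δ_g† Δ_g ψ⟩ ≤ 20 L² (Σ_e g(e)²) ((L² - N + 3) ‖ψ‖² + 2 Re ⟨ψ, Σ_x n_{x↑}n_{x↓} ψ⟩)`**;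
  `re_expect_pairField_dWave_conjTranspose_mul_le_carrier` — the `d`-wave case (`Σ_e g_d(e)² = 4`):
  `Re ⟨ψ, Δ_d† Δ_d ψ⟩ ≤ 80 L² ((L² - N + 3) ‖ψ‖² + 2 ⟨N_d⟩)`.

In density language: the `d_{x²-y²}` pair-field density of ANY state of hole doping `δ = 1 - N/L²`
and doublon density `n_d = ⟨N_d⟩/L²` is at most `80 (δ + 2 n_d) + 240/L²`. For Gutzwiller-projected
(`U = ∞`) states `n_d = 0` and the order parameter density is `O(δ)`; for Hubbard ground states
`n_d ≤ 4t/U` (`HubbardGroundStateDoublonBound`). Kinematics only — no Hamiltonian enters. Compare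
Yang's unconstrained bound `2(1 - δ²)` (`PairFieldYangCeiling`). The mechanism ("a removed singlet
pair leaves two holes; coherence between two such removals needs pre-existing holes or doublons")
is the rigorous kernel of the Gutzwiller factor `g_t = 2δ/(1+δ)` of renormalised mean-field theory
(Zhang–Gross–Rice–Shiba, Supercond. Sci. Technol. 1 (1988) 36, §2); Scalapino, Phys. Rep. 250
(1995) 329, §2 for the pair field. Folklore estimates; no definition and no named fact is introduced.
-/

namespace Literature.MathematicalPhysics.QuantumLattice

open Matrix Finset
open Literature.Probability.LatticeModels
open scoped ComplexOrder

namespace PairFieldCarrier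

variable (g : Site 2 → ℝ) (L : ℕ) [NeZero L]

/-! ### The family of elementary terms of the pair field -/

omit [NeZero L] in
/-- The two annihilated orbitals of an elementary term differ (their spins differ). [folklore] -/
theorem orb_ne_orb_sub (X Y : FermionTorus 2 L) (κ : Fin 2) : orb X κ ≠ orb Y (1 - κ) := by
  rw [Ne, orb_inj, not_and_or]
  right
  fin_cases κ <;> decide

/-- `(Δ_g ψ)(s) = Σ_{j = (x, e, κ)} w_j (c_{(x,κ)} c_{(x+e,κ̄)} ψ)(s)` with `w_{(x,e,0)} = g(e)/√2`,
`w_{(x,e,1)} = -g(e)/√2`. Scalapino, Phys. Rep. 250 (1995) 329, §2 eq. (2.2). [folklore] -/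
theorem pairField_mulVec_apply_eq_sum (ψ : Fock (Orb (FermionTorus 2 L))) (s : Finset (Orb (FermionTorus 2 L))) :
    (pairField g L *ᵥ ψ) s =
      ∑ j : TorusSite 2 L × ↥(insert (0 : Site 2) unitSteps) × Fin 2,
        (if j.2.2 = 0 then (((g (j.2.1 : Site 2) / Real.sqrt 2 : ℝ) : ℂ)) else -(((g (j.2.1 : Site 2) / Real.sqrt 2 : ℝ) : ℂ))) *
          ((annihilation (orb (FermionTorus.ofTorusSite j.1) j.2.2) *
            annihilation (orb (FermionTorus.ofTorusSite (j.1 + Torus.proj L (j.2.1 : Site 2))) (1 - j.2.2))) *ᵥ ψ) s := by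
  rw [Fintype.sum_prod_type]
  unfold pairField
  rw [Matrix.sum_mulVec, Finset.sum_apply]
  refine Finset.sum_congr rfl fun x _ => ?_
  rw [Fintype.sum_prod_type, Finset.sum_coe_sort (insert (0 : Site 2) unitSteps)
    (fun e => ∑ κ : Fin 2, (if κ = 0 then (((g e / Real.sqrt 2 : ℝ) : ℂ)) else
      -(((g e / Real.sqrt 2 : ℝ) : ℂ))) *
        ((annihilation (orb (FermionTorus.ofTorusSite x) κ) *
          annihilation (orb (FermionTorus.ofTorusSite (x + Torus.proj L e)) (1 - κ))) *ᵥ ψ) s)]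
  unfold localPair
  rw [Matrix.sum_mulVec, Finset.sum_apply]
  refine Finset.sum_congr rfl fun e _ => ?_
  simp only [Fin.sum_univ_two, Fin.isValue, if_true, one_ne_zero, if_false, sub_zero, sub_self,
    Matrix.smul_mulVec, Pi.smul_apply, smul_eq_mul, Matrix.sub_mulVec, Pi.sub_apply]
  ring

/-- `Σ_j |w_j|² = L² Σ_e g(e)²` (two spin orderings of modulus `|g(e)|/√2` per site and step).
Scalapino, Phys. Rep. 250 (1995) 329, §2. [folklore] -/
theorem sum_norm_sq_weight :
    ∑ j : TorusSite 2 L × ↥(insert (0 : Site 2) unitSteps) × Fin 2,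
        ‖(if j.2.2 = 0 then (((g (j.2.1 : Site 2) / Real.sqrt 2 : ℝ) : ℂ)) else -(((g (j.2.1 : Site 2) / Real.sqrt 2 : ℝ) : ℂ)))‖ ^ 2 =
      (L : ℝ) ^ 2 * ∑ e ∈ insert (0 : Site 2) unitSteps, g e ^ 2 := by
  have hs2 : Real.sqrt 2 ^ 2 = 2 := Real.sq_sqrt (by norm_num)
  have hval : ∀ e : Site 2, ‖((g e / Real.sqrt 2 : ℝ) : ℂ)‖ ^ 2 = g e ^ 2 / 2 := by
    intro e
    rw [Complex.norm_real, Real.norm_eq_abs, sq_abs, div_pow, hs2]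
  rw [Fintype.sum_prod_type]
  simp only [Fintype.sum_prod_type, Fin.sum_univ_two, Fin.isValue, if_true, one_ne_zero, if_false,
    norm_neg, hval]
  rw [Finset.sum_const, Finset.card_univ, nsmul_eq_mul, PairFieldYang.card_torusSite_two_cast L,
    Finset.sum_coe_sort (insert (0 : Site 2) unitSteps) (fun e => g e ^ 2 / 2 + g e ^ 2 / 2),
    Finset.mul_sum, Finset.mul_sum]
  refine Finset.sum_congr rfl fun e _ => ?_
  ring

/-- There are five steps `{0} ∪ unitSteps`. Scalapino, Phys. Rep. 250 (1995) 329, §2. [folklore] -/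
theorem card_insert_zero_unitSteps : (insert (0 : Site 2) unitSteps).card = 5 := by
  decide

/-- **Where the non-far partners live.** If `j' = (x', e', κ')` is NOT far from `j = (x, e, κ)`
(one of the orbitals `a_j, b_j` meets `{a_{j'}, o_{j'}}` or conversely), then `x' = x`, `x' = x + e`
or `x' + e' = x`. [folklore] -/
theorem near_cases (j j' : TorusSite 2 L × ↥(insert (0 : Site 2) unitSteps) × Fin 2)
    (h : ¬ ((orb (FermionTorus.ofTorusSite j.1) j.2.2 ≠ orb (FermionTorus.ofTorusSite j'.1) j'.2.2 ∧
          orb (FermionTorus.ofTorusSite j.1) j.2.2 ≠ orb (FermionTorus.ofTorusSite j'.1) (1 - j'.2.2) ∧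
          orb (FermionTorus.ofTorusSite (j.1 + Torus.proj L (j.2.1 : Site 2))) (1 - j.2.2) ≠
            orb (FermionTorus.ofTorusSite j'.1) j'.2.2 ∧
          orb (FermionTorus.ofTorusSite (j.1 + Torus.proj L (j.2.1 : Site 2))) (1 - j.2.2) ≠
            orb (FermionTorus.ofTorusSite j'.1) (1 - j'.2.2)) ∧
        (orb (FermionTorus.ofTorusSite j'.1) j'.2.2 ≠ orb (FermionTorus.ofTorusSite j.1) j.2.2 ∧
          orb (FermionTorus.ofTorusSite j'.1) j'.2.2 ≠ orb (FermionTorus.ofTorusSite j.1) (1 - j.2.2) ∧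
          orb (FermionTorus.ofTorusSite (j'.1 + Torus.proj L (j'.2.1 : Site 2))) (1 - j'.2.2) ≠
            orb (FermionTorus.ofTorusSite j.1) j.2.2 ∧
          orb (FermionTorus.ofTorusSite (j'.1 + Torus.proj L (j'.2.1 : Site 2))) (1 - j'.2.2) ≠
            orb (FermionTorus.ofTorusSite j.1) (1 - j.2.2)))) :
    j'.1 = j.1 ∨ j'.1 = j.1 + Torus.proj L (j.2.1 : Site 2) ∨ j'.1 + Torus.proj L (j'.2.1 : Site 2) = j.1 := by
  have hinj : Function.Injective (FermionTorus.ofTorusSite (d := 2) (L := L)) :=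
    (FermionTorus.equivTorusSite (d := 2) (L := L)).symm.injective
  simp only [not_and_or, Ne, not_not] at h
  simp only [orb_inj] at h
  rcases h with (h | h | h | h) | (h | h | h | h)
  · exact Or.inl (hinj h.1).symm
  · exact Or.inl (hinj h.1).symm
  · exact Or.inr (Or.inl (hinj h.1).symm)
  · exact Or.inr (Or.inl (hinj h.1).symm)
  · exact Or.inl (hinj h.1)
  · exact Or.inl (hinj h.1)
  · exact Or.inr (Or.inr (hinj h.1))
  · exact Or.inr (Or.inr (hinj h.1))

omit [NeZero L] in
/-- **Degree bound.** A set of indices `j = (x, e, κ)` each satisfying `x = c₁`, `x = c₂` or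
`x + e = c₃` has at most `3 · 10 = 30` elements (on each piece `j ↦ (e, κ)` is injective).
[folklore] -/
theorem card_le_thirty (c₁ c₂ c₃ : TorusSite 2 L)
    (S : Finset (TorusSite 2 L × ↥(insert (0 : Site 2) unitSteps) × Fin 2))
    (hS : ∀ j ∈ S, j.1 = c₁ ∨ j.1 = c₂ ∨ j.1 + Torus.proj L (j.2.1 : Site 2) = c₃) :
    S.card ≤ 30 := by
  classical
  set S1 := S.filter fun j => j.1 = c₁ with hS1
  set S2 := S.filter fun j => j.1 = c₂ with hS2
  set S3 := S.filter fun j => j.1 + Torus.proj L (j.2.1 : Site 2) = c₃ with hS3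
  have hsub : S ⊆ S1 ∪ S2 ∪ S3 := by
    intro j hj
    simp only [hS1, hS2, hS3, Finset.mem_union, Finset.mem_filter]
    rcases hS j hj with h | h | h
    · exact Or.inl (Or.inl ⟨hj, h⟩)
    · exact Or.inl (Or.inr ⟨hj, h⟩)
    · exact Or.inr ⟨hj, h⟩
  have hten : Fintype.card (↥(insert (0 : Site 2) unitSteps) × Fin 2) = 10 := by
    rw [Fintype.card_prod, Fintype.card_coe, card_insert_zero_unitSteps, Fintype.card_fin]
  have hcard : ∀ (T : Finset (TorusSite 2 L × ↥(insert (0 : Site 2) unitSteps) × Fin 2)),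
      Set.InjOn (fun j : TorusSite 2 L × ↥(insert (0 : Site 2) unitSteps) × Fin 2 => j.2)
        (T : Set (TorusSite 2 L × ↥(insert (0 : Site 2) unitSteps) × Fin 2)) → T.card ≤ 10 := by
    intro T hT
    rw [← hten, ← Finset.card_univ]
    exact Finset.card_le_card_of_injOn
      (fun j : TorusSite 2 L × ↥(insert (0 : Site 2) unitSteps) × Fin 2 => j.2)
      (fun _ _ => Finset.mem_univ _) hT
  have h1 : S1.card ≤ 10 := hcard S1 fun j₁ hj₁ j₂ hj₂ h => by
    have e1 := (Finset.mem_filter.1 (Finset.mem_coe.1 hj₁)).2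
    have e2 := (Finset.mem_filter.1 (Finset.mem_coe.1 hj₂)).2
    exact Prod.ext (e1.trans e2.symm) h
  have h2 : S2.card ≤ 10 := hcard S2 fun j₁ hj₁ j₂ hj₂ h => by
    have e1 := (Finset.mem_filter.1 (Finset.mem_coe.1 hj₁)).2
    have e2 := (Finset.mem_filter.1 (Finset.mem_coe.1 hj₂)).2
    exact Prod.ext (e1.trans e2.symm) h
  have h3 : S3.card ≤ 10 := hcard S3 fun j₁ hj₁ j₂ hj₂ h => by
    have e1 := (Finset.mem_filter.1 (Finset.mem_coe.1 hj₁)).2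
    have e2 := (Finset.mem_filter.1 (Finset.mem_coe.1 hj₂)).2
    have h' : j₁.2.1 = j₂.2.1 := congrArg Prod.fst h
    have : j₁.1 = j₂.1 := by
      have := e1.trans e2.symm
      rw [h'] at this
      exact add_right_cancel this
    exact Prod.ext this h
  exact (Finset.card_le_card hsub).trans ((Finset.card_union_le _ _).trans (add_le_add
    ((Finset.card_union_le _ _).trans (add_le_add h1 h2)) h3))

/-! ### Hole and doublon weights -/

/-- A site-indexed weight summed over the family counts each site `10` times (five steps, two spin
orderings). [folklore] -/
theorem sum_family_siteWeight (F : TorusSite 2 L → ℝ) :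
    ∑ j : TorusSite 2 L × ↥(insert (0 : Site 2) unitSteps) × Fin 2, F j.1 =
      10 * ∑ x : TorusSite 2 L, F x := by
  rw [Fintype.sum_prod_type, Finset.mul_sum]
  refine Finset.sum_congr rfl fun x _ => ?_
  simp only [Finset.sum_const, Finset.card_univ, Fintype.card_prod, Fintype.card_coe,
    card_insert_zero_unitSteps, Fintype.card_fin, nsmul_eq_mul]
  norm_num

omit [NeZero L] in
/-- **`#holes(t) + #t = |Λ| + #doublons(t)`** for a configuration `t` of Hubbard orbitals on the
torus (every site is empty, singly or doubly occupied), written with indicator sums. [folklore] -/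
theorem sum_holeInd_add_card (t : Finset (Orb (FermionTorus 2 L))) :
    (∑ x : FermionTorus 2 L, (if orb x 0 ∉ t ∧ orb x 1 ∉ t then (1 : ℝ) else 0)) + t.card =
      Fintype.card (FermionTorus 2 L) +
        ∑ x : FermionTorus 2 L, (if orb x 0 ∈ t ∧ orb x 1 ∈ t then (1 : ℝ) else 0) := by
  classical
  rw [card_eq_upPart_add_downPart t, upPart, downPart, Finset.card_filter, Finset.card_filter,
    ← Finset.card_univ, Finset.card_eq_sum_ones]
  push_cast
  rw [← Finset.sum_add_distrib, ← Finset.sum_add_distrib, ← Finset.sum_add_distrib]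
  refine Finset.sum_congr rfl fun x _ => ?_
  by_cases h0 : orb x 0 ∈ t <;> by_cases h1 : orb x 1 ∈ t <;> simp [h0, h1]

omit [NeZero L] in
/-- The hole weight of an `N`-particle vector: `Σ_x Σ_t [x empty in t] |ψ t|² = (|Λ| - N) ‖ψ‖² +
Σ_x Σ_t [x doubly occupied in t] |ψ t|²` (on the support of `ψ`, `#t = N`). [folklore] -/
theorem sum_holeWeight_eq_of_isNParticle {N : ℕ} {ψ : Fock (Orb (FermionTorus 2 L))}
    (hψ : IsNParticle N ψ) :
    ∑ x : FermionTorus 2 L, ∑ t : Finset (Orb (FermionTorus 2 L)),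
        (if orb x 0 ∉ t ∧ orb x 1 ∉ t then (1 : ℝ) else 0) * ‖ψ t‖ ^ 2 =
      ((Fintype.card (FermionTorus 2 L) : ℝ) - N) * (∑ t : Finset (Orb (FermionTorus 2 L)), ‖ψ t‖ ^ 2) +
        ∑ x : FermionTorus 2 L, ∑ t : Finset (Orb (FermionTorus 2 L)),
          (if orb x 0 ∈ t ∧ orb x 1 ∈ t then (1 : ℝ) else 0) * ‖ψ t‖ ^ 2 := by
  classical
  rw [Finset.sum_comm, Finset.sum_comm (f := fun (x : FermionTorus 2 L) (t : Finset (Orb (FermionTorus 2 L))) =>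
      (if orb x 0 ∈ t ∧ orb x 1 ∈ t then (1 : ℝ) else 0) * ‖ψ t‖ ^ 2),
    Finset.mul_sum, ← Finset.sum_add_distrib]
  refine Finset.sum_congr rfl fun t _ => ?_
  rw [← Finset.sum_mul, ← Finset.sum_mul]
  by_cases ht : t.card = N
  · have h := sum_holeInd_add_card L t
    rw [ht] at h
    have : (∑ x : FermionTorus 2 L, (if orb x 0 ∉ t ∧ orb x 1 ∉ t then (1 : ℝ) else 0)) =
        (Fintype.card (FermionTorus 2 L) : ℝ) - N +
          ∑ x : FermionTorus 2 L, (if orb x 0 ∈ t ∧ orb x 1 ∈ t then (1 : ℝ) else 0) := by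
      linarith
    rw [this]
    ring
  · rw [hψ t ht]
    simp

omit [NeZero L] in
/-- The doublon weight is the expectation of the Hubbard interaction:
`Σ_x Σ_t [x doubly occupied in t] |ψ t|² = Re ⟨ψ, (Σ_x n_{x↑} n_{x↓}) ψ⟩`. Tasaki (2020) §9.3. [folklore] -/
theorem sum_doublonWeight_eq_re_expect (ψ : Fock (Orb (FermionTorus 2 L))) :
    ∑ x : FermionTorus 2 L, ∑ t : Finset (Orb (FermionTorus 2 L)),
        (if orb x 0 ∈ t ∧ orb x 1 ∈ t then (1 : ℝ) else 0) * ‖ψ t‖ ^ 2 =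
      (star ψ ⬝ᵥ ((∑ x : FermionTorus 2 L, numberOp x 0 * numberOp x 1 :
        Matrix (Finset (Orb (FermionTorus 2 L))) (Finset (Orb (FermionTorus 2 L))) ℂ) *ᵥ ψ)).re := by
  classical
  rw [Matrix.sum_mulVec, dotProduct_sum, Complex.re_sum]
  refine Finset.sum_congr rfl fun x _ => ?_
  rw [numberOp_mul_numberOp_eq_diagonal]
  simp only [dotProduct, mulVec_diagonal, Pi.star_apply, Complex.re_sum]
  refine Finset.sum_congr rfl fun t _ => ?_
  split_ifs with h
  · rw [one_mul, one_mul, Complex.star_def, Complex.conj_mul' (ψ t)]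
    norm_cast
  · simp

/-! ### The carrier bound for the pair field -/

/-- **No pair-field order without charge carriers.** For every form factor `g`, every side `L`
and every Fock vector `ψ` of particle number `N` on the torus `(ℤ/Lℤ)²`:
`Re ⟨ψ, Δ_g† Δ_g ψ⟩ ≤ 20 L² (Σ_e g(e)²) ((L² - N + 3) ‖ψ‖² + 2 Re ⟨ψ, Σ_x n_{x↑}n_{x↓} ψ⟩)` — the
pair-field density is at most `20 ‖g‖² (hole density + doublon density) + O(1/L²)` times constants.
(Carrier bound of `PairFieldCarrierBoundAssembly` for the family of `10 L²` elementary terms, degree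
`30`, weights `L² Σ g²`, hole weight `= (L² - N)‖ψ‖² +` doublon weight.) Scalapino, Phys. Rep. 250
(1995) 329, §2; Zhang–Gross–Rice–Shiba (1988) §2. [folklore] -/
theorem re_expect_pairField_conjTranspose_mul_le_carrier {N : ℕ} {ψ : Fock (Orb (FermionTorus 2 L))}
    (hψ : IsNParticle N ψ) :
    (star ψ ⬝ᵥ (((pairField g L)ᴴ * pairField g L) *ᵥ ψ)).re ≤
      20 * (L : ℝ) ^ 2 * (∑ e ∈ insert (0 : Site 2) unitSteps, g e ^ 2) *
        (((L : ℝ) ^ 2 - N + 3) * (star ψ ⬝ᵥ ψ).re +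
          2 * (star ψ ⬝ᵥ ((∑ x : FermionTorus 2 L, numberOp x 0 * numberOp x 1 :
            Matrix (Finset (Orb (FermionTorus 2 L))) (Finset (Orb (FermionTorus 2 L))) ℂ) *ᵥ ψ)).re) := by
  classical
  -- both sides in coordinates
  have hL : (star ψ ⬝ᵥ (((pairField g L)ᴴ * pairField g L) *ᵥ ψ)).re =
      ∑ s, ‖(pairField g L *ᵥ ψ) s‖ ^ 2 := by
    have hexp : star ψ ⬝ᵥ (((pairField g L)ᴴ * pairField g L) *ᵥ ψ) =
        star (pairField g L *ᵥ ψ) ⬝ᵥ (pairField g L *ᵥ ψ) :=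
      PosSemidefTrace.expect_conjTranspose_mul _ _ ψ
    rw [hexp, Matrix.star_dotProduct_self_eq_ofReal, Complex.ofReal_re]
  have hnorm : (star ψ ⬝ᵥ ψ).re = ∑ t, ‖ψ t‖ ^ 2 := by
    rw [Matrix.star_dotProduct_self_eq_ofReal, Complex.ofReal_re]
  rw [hL, hnorm, ← sum_doublonWeight_eq_re_expect L]
  -- the abstract carrier bound, with this file's indicators
  have hmain := sum_norm_sq_pairSum_le_carrier
    (J := TorusSite 2 L × ↥(insert (0 : Site 2) unitSteps) × Fin 2)
    (fun j => orb (FermionTorus.ofTorusSite j.1) j.2.2)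
    (fun j => orb (FermionTorus.ofTorusSite (j.1 + Torus.proj L (j.2.1 : Site 2))) (1 - j.2.2))
    (fun j => orb (FermionTorus.ofTorusSite j.1) (1 - j.2.2))
    (fun j => if j.2.2 = 0 then (((g (j.2.1 : Site 2) / Real.sqrt 2 : ℝ) : ℂ)) else
      -(((g (j.2.1 : Site 2) / Real.sqrt 2 : ℝ) : ℂ)))
    ψ (fun j => orb_ne_orb_sub L _ _ _) (D := 30)
    (fun j t => if orb (FermionTorus.ofTorusSite j.1) 0 ∈ t ∧ orb (FermionTorus.ofTorusSite j.1) 1 ∈ t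
      then (1 : ℝ) else 0)
    (fun j t => if orb (FermionTorus.ofTorusSite j.1) 0 ∉ t ∧ orb (FermionTorus.ofTorusSite j.1) 1 ∉ t
      then (1 : ℝ) else 0)
    (fun j j' => if j'.1 = j.1 ∨ j'.1 = j.1 + Torus.proj L (j.2.1 : Site 2) ∨
        j'.1 + Torus.proj L (j'.2.1 : Site 2) = j.1 then (1 : ℝ) else 0)
    (fun j t => by positivity)
    (fun j t ha ho => by
      have hboth : orb (FermionTorus.ofTorusSite j.1) 0 ∈ t ∧ orb (FermionTorus.ofTorusSite j.1) 1 ∈ t := by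
        rcases j with ⟨x, e, κ⟩
        fin_cases κ
        · exact ⟨ha, ho⟩
        · exact ⟨ho, ha⟩
      simp [hboth])
    (fun j t => by positivity)
    (fun j t ha ho => by
      have hboth : orb (FermionTorus.ofTorusSite j.1) 0 ∉ t ∧ orb (FermionTorus.ofTorusSite j.1) 1 ∉ t := by
        rcases j with ⟨x, e, κ⟩
        fin_cases κ
        · exact ⟨ha, ho⟩
        · exact ⟨ho, ha⟩
      simp [hboth])
    (fun j j' => by positivity)
    (fun j j' h => by simp [near_cases L j j' h])
    (fun j => by
      rw [Finset.sum_boole]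
      exact_mod_cast card_le_thirty L j.1 (j.1 + Torus.proj L (j.2.1 : Site 2)) j.1 _
        fun j' hj' => (Finset.mem_filter.1 hj').2)
    (fun j' => by
      rw [Finset.sum_boole]
      refine (Nat.cast_le.2 (card_le_thirty L j'.1 (j'.1 + Torus.proj L (j'.2.1 : Site 2)) j'.1 _
        fun j hj => ?_)).trans (by norm_num)
      rcases (Finset.mem_filter.1 hj).2 with h | h | h
      · exact Or.inl h.symm
      · exact Or.inr (Or.inr h.symm)
      · exact Or.inr (Or.inl (eq_sub_of_add_eq h ▸ by abel)))
  have hcard : (Fintype.card (FermionTorus 2 L) : ℝ) = (L : ℝ) ^ 2 := by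
    have : Fintype.card (FermionTorus 2 L) = L ^ 2 := by simp
    rw [this]; push_cast; ring
  -- the hole and doublon weights, summed over sites of the fermionic torus
  have hHx : ∑ x : TorusSite 2 L, ∑ t : Finset (Orb (FermionTorus 2 L)),
      (if orb (FermionTorus.ofTorusSite x) 0 ∉ t ∧ orb (FermionTorus.ofTorusSite x) 1 ∉ t
        then (1 : ℝ) else 0) * ‖ψ t‖ ^ 2 =
      ∑ X : FermionTorus 2 L, ∑ t : Finset (Orb (FermionTorus 2 L)),
        (if orb X 0 ∉ t ∧ orb X 1 ∉ t then (1 : ℝ) else 0) * ‖ψ t‖ ^ 2 :=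
    Fintype.sum_equiv (FermionTorus.equivTorusSite (d := 2) (L := L)).symm _ _ (fun x => rfl)
  have hDx : ∑ x : TorusSite 2 L, ∑ t : Finset (Orb (FermionTorus 2 L)),
      (if orb (FermionTorus.ofTorusSite x) 0 ∈ t ∧ orb (FermionTorus.ofTorusSite x) 1 ∈ t
        then (1 : ℝ) else 0) * ‖ψ t‖ ^ 2 =
      ∑ X : FermionTorus 2 L, ∑ t : Finset (Orb (FermionTorus 2 L)),
        (if orb X 0 ∈ t ∧ orb X 1 ∈ t then (1 : ℝ) else 0) * ‖ψ t‖ ^ 2 :=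
    Fintype.sum_equiv (FermionTorus.equivTorusSite (d := 2) (L := L)).symm _ _ (fun x => rfl)
  simp only [← pairField_mulVec_apply_eq_sum g L ψ] at hmain
  rw [sum_norm_sq_weight g L,
    sum_family_siteWeight L (fun x => ∑ t : Finset (Orb (FermionTorus 2 L)),
      (if orb (FermionTorus.ofTorusSite x) 0 ∈ t ∧ orb (FermionTorus.ofTorusSite x) 1 ∈ t
        then (1 : ℝ) else 0) * ‖ψ t‖ ^ 2),
    sum_family_siteWeight L (fun x => ∑ t : Finset (Orb (FermionTorus 2 L)),
      (if orb (FermionTorus.ofTorusSite x) 0 ∉ t ∧ orb (FermionTorus.ofTorusSite x) 1 ∉ t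
        then (1 : ℝ) else 0) * ‖ψ t‖ ^ 2),
    hHx, hDx, sum_holeWeight_eq_of_isNParticle L hψ, hcard] at hmain
  refine hmain.trans (le_of_eq ?_)
  ring

/-- **The `d_{x²-y²}` case**: for every `N`-particle Fock vector `ψ` on the torus of side `L`,
`Re ⟨ψ, Δ_d† Δ_d ψ⟩ ≤ 80 L² ((L² - N + 3) ‖ψ‖² + 2 Re ⟨ψ, Σ_x n_{x↑}n_{x↓} ψ⟩)`: the `d`-wave pair-field
density of a state of hole doping `δ` and doublon density `n_d` is at most `80(δ + 2n_d) + 240/L²`.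
Scalapino, Phys. Rep. 250 (1995) 329, §2 eq. (2.4); Zhang–Gross–Rice–Shiba (1988) §2. [folklore] -/
theorem re_expect_pairField_dWave_conjTranspose_mul_le_carrier {N : ℕ}
    {ψ : Fock (Orb (FermionTorus 2 L))} (hψ : IsNParticle N ψ) :
    (star ψ ⬝ᵥ (((pairField dWaveFormFactor L)ᴴ * pairField dWaveFormFactor L) *ᵥ ψ)).re ≤
      80 * (L : ℝ) ^ 2 *
        (((L : ℝ) ^ 2 - N + 3) * (star ψ ⬝ᵥ ψ).re +
          2 * (star ψ ⬝ᵥ ((∑ x : FermionTorus 2 L, numberOp x 0 * numberOp x 1 :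
            Matrix (Finset (Orb (FermionTorus 2 L))) (Finset (Orb (FermionTorus 2 L))) ℂ) *ᵥ ψ)).re) := by
  have h := re_expect_pairField_conjTranspose_mul_le_carrier dWaveFormFactor L hψ
  rw [PairFieldYang.sum_sq_dWaveFormFactor] at h
  linarith

end PairFieldCarrier

end Literature.MathematicalPhysics.QuantumLattice
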